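/-
Copyright: seat `ym-line-sll-p3` (prover-ym-line-sll-p3-g0-0), route `SoftLoopLongLag`, cruxes `SoftLoopLagFloorToTorus`
(stmt-QuantumFields-22504) / `ColdBoxSoftLoopLagFloor` (stmt-QuantumFields-22503, rev 2 = 23990), lines `birth`.
-/
import Summits.QuantumFields.YangMills.Theorems.SoftLoopLongLagSoftLoopLagFloorToTorusDlrTransferGoodFloorG
import Literature.MathematicalPhysics.QuantumLattice.LatticeGaugeDLRSymmetry
import Literature.MathematicalPhysics.QuantumLattice.LatticeGaugeDLRSpecificationProofs
import Literature.Probability.LatticeModels.ONModelDobrushinStates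

/-!
# Route `SoftLoopLongLag` — the IN-BOX MIXTURE PLUMBING (WAVE 3 P3-b of the lead of crux K′), part 1 of 2: conditioning removed
# two-sidedly; the inner cube of `ColdBoxAllGroups` inside the lag box; translation bridge for the kernels; DLR consistency in `ℤ⁴`

WHY.  T′ (crux `ColdBoxSoftLoopLagFloor`, re-typed: explicit floor `c·R³·β^{-2}` for crude-good cold-typical data in the lag box
`Λ_n = lagBox n`, `n = ⌈β^a⌉`) is to be assembled from DATUM statements of the one-scale engine of the sibling route `ColdBoxAllGroups`,
which live in the CUBE geometry `Λ₀ = AxialGauge.boxEdges 4 (2H+1)` (vertex cube `[0,2H]⁴`, kernel `boxKernelG r.ρ β H ζ`, centre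
`boxCentre H`), `H = ⌈β^b⌉ ≪ n`: an inner datum floor (E1) and an inner datum mean smoothness (E2) for the translated soft-loop observable
`F_H = F_R ∘ configShift (−boxCentre H)`.  The mixture step is the law of total covariance for the OUTER kernel `μ = γ_{Λ_n}(·|η)` written as
the mixture `μ = ∫ γ_{Λ'}(·|ζ) dμ(ζ)` over the centred inner cube `Λ' = Λ₀ − boxCentre H ⊆ Λ_n` (DLR consistency of the lattice Yang–Mills
specification INSIDE `ℤ⁴`, Georgii 2011 Def. 1.23 (iii); tree `isSpecification_ymSpecification_of_t2Space`,
`IsSpecification.integral_integral_consistent`), the inner kernels being moved to the cube by translation covariance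
(`ymSpecification_map_configShift`, Georgii 2011 (5.8)).  Part 2 (`…ColdBoxInnerMixtureG`) proves the T‴-shaped interface theorem.

WHAT (every compact `G`, `r : LatticeRep G`):
* §1 `cov_sub_measureReal_mul_condCov_le` — the UPPER companion of `measureReal_mul_condCov_sub_le_cov`:
  `Cov_γ(F, G) ≤ γ(A)·Cov_{γ[|A]}(F, G) + 5B²γ(Aᶜ)` (so `|γ(A)·Cov_ν − Cov_γ| ≤ 5B²γ(Aᶜ)`; Durrett 2019 §4.1);
* §2 cube-in-box geometry: `Λ' ⊆ Λ_n` for `H ≤ n`; the corona plaquettes of the cube and the plaquettes touching `Λ₀`, shifted by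
  `−boxCentre H`, touch `Λ_n` (`H + 1 ≤ n`); hence ON THE OUTER COLD EVENT (threshold `β^{κ−1}`) the shifted datum is `CrudeGoodG … (κ/2)`
  for the cube and the shifted inner hot event (threshold `β^{2κ−1} ≥ β^{κ−1}`) is empty: `innerHot_subset_outerHot`,
  `crudeGoodG_configShift_of_mem_coldEvent`;
* §3 translation bridge: `∫ Ψ dγ_{Λ'}(·|ζ) = ∫ Ψ ∘ configShift(−c) dγ_{Λ₀}(·|configShift c ζ)` and the set form (`integral_innerKernel_eq`,
  `innerKernel_real_eq`);
* §4 DLR consistency, integral and set forms, for `Λ' ⊆ Λ` (`integral_ymSpecification_consistent`, `measureReal_ymSpecification_consistent`).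

HONEST LABEL: rung R2xi-G RECORD label (leaf `WeakCouplingRates.XiPow`, an UPPER bound on the lattice mass gap); NOT the Clay mass gap; no
summit statement is touched.

References: H.-O. Georgii, *Gibbs Measures and Phase Transitions* (2011) Def. 1.23, §5.1 (5.8); S. Friedli, Y. Velenik (2017) Def. 6.9;
R. Durrett (2019) §4.1; E. Seiler, LNP 159 (1982) Ch. 2.
-/

set_option autoImplicit false

noncomputable section

open MeasureTheory Filter Topology
open Literature.Probability.LatticeModels (Site box mem_box box_mono IsSpecification)
open Literature.MathematicalPhysics Literature.MathematicalPhysics.QuantumFieldTheory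
open Literature.MathematicalPhysics.QuantumLattice
open Summit.QuantumFields.YangMills.Theorems.WeakCouplingRates
open Summit.QuantumFields.YangMills.Theorems.ColdBoxAllGroups (CrudeGoodG boxKernelG measurable_plaqCostAtG)

namespace Summit.QuantumFields.YangMills.Theorems.SoftLoopLongLag

/-! ### §1. Conditioning on a typical event, upper side -/

section Cond

variable {Ω : Type*} [MeasurableSpace Ω] {γ : Measure Ω} [IsProbabilityMeasure γ] {A : Set Ω}

/-- **Covariance through conditioning on a typical event, upper side**: `Cov_γ(F, G) ≤ γ(A)·Cov_{γ[|A]}(F, G) + 5B²·γ(Aᶜ)` for measurable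
`F, G` with `|F|, |G| ≤ B` and `γ(A) ≠ 0` (same five cross terms as `measureReal_mul_condCov_sub_le_cov`; Durrett 2019 §4.1). [folklore] -/
theorem cov_sub_measureReal_mul_condCov_le (hA : MeasurableSet A) (hA0 : γ A ≠ 0) {F G : Ω → ℝ}
    (hFm : Measurable F) (hGm : Measurable G) {B : ℝ} (hFB : ∀ ω, |F ω| ≤ B) (hGB : ∀ ω, |G ω| ≤ B) :
    (∫ ω, F ω * G ω ∂γ) - (∫ ω, F ω ∂γ) * ∫ ω, G ω ∂γ ≤
      γ.real A * ((∫ ω, F ω * G ω ∂(ProbabilityTheory.cond γ A)) -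
        (∫ ω, F ω ∂(ProbabilityTheory.cond γ A)) * ∫ ω, G ω ∂(ProbabilityTheory.cond γ A)) + 5 * B ^ 2 * γ.real Aᶜ := by
  haveI : IsProbabilityMeasure (ProbabilityTheory.cond γ A) := ProbabilityTheory.cond_isProbabilityMeasure hA0
  obtain ⟨ω₁⟩ := nonempty_of_isProbabilityMeasure γ
  have hB : 0 ≤ B := (abs_nonneg _).trans (hFB ω₁)
  have bdd : ∀ {f : Ω → ℝ} (C : ℝ) (μ : Measure Ω) [IsFiniteMeasure μ], Measurable f → (∀ ω, |f ω| ≤ C) →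
      Integrable f μ := fun C μ _ hf hC =>
    Integrable.of_bound hf.aestronglyMeasurable C (ae_of_all _ fun ω => by simpa [Real.norm_eq_abs] using hC ω)
  have mean : ∀ (f : Ω → ℝ) (C : ℝ) (μ : Measure Ω) [IsProbabilityMeasure μ], (∀ ω, |f ω| ≤ C) →
      |∫ ω, f ω ∂μ| ≤ C := fun f C μ _ hC => by
    have h := norm_integral_le_of_norm_le_const (μ := μ) (f := f) (C := C) (ae_of_all _ fun ω => by
      rw [Real.norm_eq_abs]; exact hC ω)
    simpa [Real.norm_eq_abs] using h
  have tail : ∀ (f : Ω → ℝ) (C : ℝ), (∀ ω, |f ω| ≤ C) → |∫ ω in Aᶜ, f ω ∂γ| ≤ C * γ.real Aᶜ := fun f C hC => by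
    have h := norm_setIntegral_le_of_norm_le_const (μ := γ) (s := Aᶜ) (f := f) (C := C) (measure_lt_top γ _)
      (fun ω _ => by rw [Real.norm_eq_abs]; exact hC ω)
    simpa [Real.norm_eq_abs] using h
  have hFGB : ∀ ω, |F ω * G ω| ≤ B ^ 2 := fun ω => by
    rw [abs_mul, sq]; exact mul_le_mul (hFB ω) (hGB ω) (abs_nonneg _) hB
  set ν := ProbabilityTheory.cond γ A with hν
  set pc : ℝ := γ.real A with hpc
  set p' : ℝ := γ.real Aᶜ with hp'
  have hp'eq : p' = 1 - pc := probReal_compl_eq_one_sub hA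
  have hpc0 : 0 ≤ pc := measureReal_nonneg
  have hp'0 : 0 ≤ p' := measureReal_nonneg
  have hpc1 : pc ≤ 1 := by linarith
  have hp'1 : p' ≤ 1 := by linarith
  set a : ℝ := ∫ ω, F ω ∂ν with ha
  set b : ℝ := ∫ ω, G ω ∂ν with hb
  set c : ℝ := ∫ ω, F ω * G ω ∂ν with hc
  set rF : ℝ := ∫ ω in Aᶜ, F ω ∂γ with hrF
  set rG : ℝ := ∫ ω in Aᶜ, G ω ∂γ with hrG
  set rFG : ℝ := ∫ ω in Aᶜ, F ω * G ω ∂γ with hrFG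
  have eF : ∫ ω, F ω ∂γ = pc * a + rF := integral_eq_measureReal_mul_integral_cond_add hA hA0 (bdd B γ hFm hFB)
  have eG : ∫ ω, G ω ∂γ = pc * b + rG := integral_eq_measureReal_mul_integral_cond_add hA hA0 (bdd B γ hGm hGB)
  have eFG : ∫ ω, F ω * G ω ∂γ = pc * c + rFG :=
    integral_eq_measureReal_mul_integral_cond_add hA hA0 (bdd (B ^ 2) γ (hFm.mul hGm) hFGB)
  have haB : |a| ≤ B := mean F B ν hFB
  have hbB : |b| ≤ B := mean G B ν hGB
  have hrFB : |rF| ≤ B * p' := tail F B hFB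
  have hrGB : |rG| ≤ B * p' := tail G B hGB
  have hrFGB : |rFG| ≤ B ^ 2 * p' := tail (fun ω => F ω * G ω) (B ^ 2) hFGB
  -- the five cross terms, upper side
  have hab : |a * b| ≤ B ^ 2 := by rw [abs_mul, sq]; exact mul_le_mul haB hbB (abs_nonneg _) hB
  have h1 : pc * p' * (a * b) ≤ B ^ 2 * p' := by
    have t0 : 0 ≤ pc * p' := mul_nonneg hpc0 hp'0
    have t1 : B ^ 2 * (pc * p') ≤ B ^ 2 * p' := mul_le_mul_of_nonneg_left (by nlinarith) (sq_nonneg B)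
    have t2 : pc * p' * (a * b) ≤ pc * p' * B ^ 2 := mul_le_mul_of_nonneg_left (abs_le.1 hab).2 t0
    linarith
  have h2 : rFG ≤ B ^ 2 * p' := (abs_le.1 hrFGB).2
  have harG : |a * rG| ≤ B * (B * p') := by rw [abs_mul]; exact mul_le_mul haB hrGB (abs_nonneg _) hB
  have hbrF : |b * rF| ≤ B * (B * p') := by rw [abs_mul]; exact mul_le_mul hbB hrFB (abs_nonneg _) hB
  have h3 : -(B ^ 2 * p') ≤ pc * (a * rG) := by
    have t1 : pc * -|a * rG| ≤ pc * (a * rG) := mul_le_mul_of_nonneg_left (neg_abs_le _) hpc0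
    have t2 : pc * |a * rG| ≤ 1 * |a * rG| := mul_le_mul_of_nonneg_right hpc1 (abs_nonneg _)
    nlinarith
  have h4 : -(B ^ 2 * p') ≤ pc * (b * rF) := by
    have t1 : pc * -|b * rF| ≤ pc * (b * rF) := mul_le_mul_of_nonneg_left (neg_abs_le _) hpc0
    have t2 : pc * |b * rF| ≤ 1 * |b * rF| := mul_le_mul_of_nonneg_right hpc1 (abs_nonneg _)
    nlinarith
  have h5 : -(B ^ 2 * p') ≤ rF * rG := by
    have t1 : |rF * rG| ≤ B * p' * (B * p') := by
      rw [abs_mul]; exact mul_le_mul hrFB hrGB (abs_nonneg _) (by positivity)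
    have t2 : B * p' * (B * p') ≤ B ^ 2 * p' := by nlinarith [sq_nonneg B, mul_nonneg (sq_nonneg B) hp'0]
    linarith [neg_abs_le (rF * rG)]
  have key : pc * p' * (a * b) = pc * (a * b) - pc ^ 2 * (a * b) := by rw [hp'eq]; ring
  rw [eF, eG, eFG]
  linarith

end Cond

/-! ### §2. The cube of `ColdBoxAllGroups` inside the lag box -/

section Geometry

variable {G : Type} [Group G] [TopologicalSpace G] [IsTopologicalGroup G] [CompactSpace G]
  [MeasurableSpace G] [BorelSpace G]

/-- Base points of edges of the cube `boxEdges 4 (2H+1)` lie in `[0, 2H]⁴`. [folklore] -/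
theorem coord_of_mem_cubeEdges {H : ℕ} {e : QuantumLattice.ZdEdge 4} (he : e ∈ AxialGauge.boxEdges 4 (2 * H + 1)) (k : Fin 4) :
    0 ≤ e.1 k ∧ e.1 k ≤ 2 * (H : ℤ) := by
  obtain ⟨x, i⟩ := e
  have h := (AxialGauge.mem_boxEdges_iff.1 he).1 k
  dsimp only
  push_cast at h
  constructor <;> omega

/-- The centred cube `Λ' = boxEdges 4 (2H+1) − boxCentre H` lies in the lag box `Λ_n` when `H ≤ n`. [folklore] -/
theorem centredCube_subset_lagBox {H n : ℕ} (hHn : H ≤ n) :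
    (AxialGauge.boxEdges 4 (2 * H + 1)).map (edgeShift (-(boxCentre H))).toEmbedding ⊆ lagBox n := by
  intro e he
  obtain ⟨e₀, he₀, rfl⟩ := Finset.mem_map.1 he
  refine Finset.mem_product.2 ⟨?_, Finset.mem_univ _⟩
  rw [mem_box]
  intro k
  have h := coord_of_mem_cubeEdges he₀ k
  simp only [Equiv.toEmbedding_apply, edgeShift_apply, Pi.add_apply, Pi.neg_apply, boxCentre]
  constructor <;> omega

omit [TopologicalSpace G] [IsTopologicalGroup G] [CompactSpace G] [BorelSpace G] in
/-- Plaquette costs of a translated configuration: `c_{x;ij}(θ_v U) = c_{x−v;ij}(U)`. [folklore] -/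
theorem plaqCostAt_configShift {N : ℕ} (ρ : G →* Matrix (Fin N) (Fin N) ℂ) (v x : Site 4) (i j : Fin 4) (U : LGConfig 4 G) :
    plaqCostAt ρ x i j (configShift v U) = plaqCostAt ρ (x - v) i j U := by
  simp only [plaqCostAt, QuantumLattice.plaquetteObs, plaquetteHolonomyZd_configShift]

/-- A plaquette based at `y` with `y`, `y + e_i`, `y + e_j` … : if its base edge `(y, p.2.1.1)` lies in `Λ_n` it touches `Λ_n`. [folklore] -/
theorem mem_plaquettesTouching_lagBox_of_mem_box {n : ℕ} {p : ZdPlaquette 4} (hp : p.1 ∈ box 4 n) :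
    p ∈ plaquettesTouching (lagBox n) :=
  mem_plaquettesTouching_iff.2 ⟨(p.1, p.2.1.1), Finset.mem_inter.2
    ⟨by simp [plaquetteEdges], Finset.mem_product.2 ⟨hp, Finset.mem_univ _⟩⟩⟩

omit [IsTopologicalGroup G] [CompactSpace G] [BorelSpace G] in
/-- **On the outer cold event the shifted datum is crude-good for the cube.**  If every plaquette touching `Λ_n` costs `≤ β^{κ−1}` on
`ζ` and `H + 1 ≤ n`, then `configShift (boxCentre H) ζ` is `CrudeGoodG r.ρ β (κ/2) H` (corona range `[−1, 2H+1]⁴` of the cube, shifted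
back by the centre, lies in `[−(H+1), H+1]⁴ ⊆ [−n, n]⁴`). [folklore] -/
theorem crudeGoodG_configShift_of_mem_coldEvent (r : LatticeRep G) {β κ : ℝ} {H n : ℕ} (hHn : H + 1 ≤ n) {ζ : LGConfig 4 G}
    (hζ : ζ ∈ coldEvent r β κ (lagBox n)) : CrudeGoodG r.ρ β (κ / 2) H (configShift (boxCentre H) ζ) := by
  intro x hx i j hij
  rw [plaqCostAt_configShift]
  have hmem : ((x - boxCentre H, ⟨(i, j), hij⟩) : ZdPlaquette 4) ∈ plaquettesTouching (lagBox n) := by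
    refine mem_plaquettesTouching_lagBox_of_mem_box ?_
    rw [mem_box]
    intro k
    have h := hx k
    simp only [Pi.sub_apply, boxCentre]
    constructor <;> omega
  have h := hζ _ hmem
  have e2 : 2 * (κ / 2) - 1 = κ - 1 := by ring
  rw [e2]
  exact h

omit [IsTopologicalGroup G] [CompactSpace G] [BorelSpace G] in
/-- **The shifted inner hot event lies in the outer hot event** (`1 ≤ β`, `0 ≤ κ`, `H + 1 ≤ n`): if some plaquette touching the cube
`boxEdges 4 (2H+1)` costs `> β^{2κ−1}` on `configShift (boxCentre H) U`, then some plaquette touching `Λ_n` costs `> β^{κ−1}` on `U`.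
[folklore] -/
theorem not_mem_coldEvent_of_innerHot (r : LatticeRep G) {β κ : ℝ} (hβ : 1 ≤ β) (hκ : 0 ≤ κ) {H n : ℕ} (hHn : H + 1 ≤ n)
    {U : LGConfig 4 G} (hU : configShift (boxCentre H) U ∉ coldEvent r β (2 * κ) (AxialGauge.boxEdges 4 (2 * H + 1))) :
    U ∉ coldEvent r β κ (lagBox n) := by
  simp only [coldEvent, Set.mem_setOf_eq, not_forall, not_le, exists_prop] at hU ⊢
  obtain ⟨p, hp, hlt⟩ := hU
  have hcost : (r.N : ℝ) - plaquetteObs r.ρ p.1 p.2.1.1 p.2.1.2 (configShift (boxCentre H) U) =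
      plaqCostAt r.ρ (p.1 - boxCentre H) p.2.1.1 p.2.1.2 U := plaqCostAt_configShift r.ρ (boxCentre H) p.1 _ _ U
  -- the shifted plaquette touches `Λ_n`
  obtain ⟨e, he⟩ := mem_plaquettesTouching_iff.1 hp
  rw [Finset.mem_inter] at he
  have hq : ((p.1 - boxCentre H, p.2) : ZdPlaquette 4) ∈ plaquettesTouching (lagBox n) := by
    refine mem_plaquettesTouching_lagBox_of_mem_box ?_
    rw [mem_box]
    intro k
    have h1 := coord_of_mem_plaquetteEdges he.1 k
    have h2 := coord_of_mem_cubeEdges he.2 k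
    simp only [Pi.sub_apply, boxCentre]
    constructor <;> omega
  refine ⟨_, hq, ?_⟩
  have hmono : β ^ (κ - 1) ≤ β ^ (2 * κ - 1) := Real.rpow_le_rpow_of_exponent_le hβ (by linarith)
  have h' : β ^ (2 * κ - 1) < plaqCostAt r.ρ (p.1 - boxCentre H) p.2.1.1 p.2.1.2 U := by rw [← hcost]; exact hlt
  exact hmono.trans_lt h'

omit [CompactSpace G] in
/-- The shifted inner hot event is measurable. [folklore] -/
theorem measurableSet_innerHot_shift [SecondCountableTopology G] (r : LatticeRep G) (β κ : ℝ) (H : ℕ) :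
    MeasurableSet {U : LGConfig 4 G | configShift (boxCentre H) U ∉ coldEvent r β (2 * κ) (AxialGauge.boxEdges 4 (2 * H + 1))} := by
  have h : MeasurableSet ((configShift (boxCentre H)) ⁻¹' (coldEvent r β (2 * κ) (AxialGauge.boxEdges 4 (2 * H + 1)))ᶜ) :=
    ((measurableSet_coldEvent r β (2 * κ) _).compl).preimage (configShift (boxCentre H)).measurable
  exact h

end Geometry

/-! ### §3. The translation bridge between the centred inner kernel and the cube kernel -/

section Bridge

variable {G : Type} [Group G] [TopologicalSpace G] [IsTopologicalGroup G] [CompactSpace G]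
  [MeasurableSpace G] [BorelSpace G]

omit [Group G] [TopologicalSpace G] [IsTopologicalGroup G] [CompactSpace G] [BorelSpace G] in
/-- `θ_{−v} θ_v = id` on configurations. [folklore] -/
theorem configShift_neg_configShift (v : Site 4) (U : LGConfig 4 G) : configShift (-v) (configShift v U) = U := by
  ext e
  simp only [configShift_apply, sub_neg_eq_add, add_sub_cancel_right, Prod.mk.eta]

omit [Group G] [TopologicalSpace G] [IsTopologicalGroup G] [CompactSpace G] [BorelSpace G] in
/-- `θ_v θ_{−v} = id` on configurations. [folklore] -/
theorem configShift_configShift_neg (v : Site 4) (U : LGConfig 4 G) : configShift v (configShift (-v) U) = U := by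
  have h := configShift_neg_configShift (-v) U
  rwa [neg_neg] at h

omit [Group G] [TopologicalSpace G] [IsTopologicalGroup G] [CompactSpace G] [BorelSpace G] in
/-- Translations of configurations commute. [folklore] -/
theorem configShift_comm (v w : Site 4) (U : LGConfig 4 G) : configShift v (configShift w U) = configShift w (configShift v U) := by
  ext e
  simp only [configShift_apply, sub_sub, add_comm]

/-- **Translation bridge, integral form.**  The centred inner kernel is the cube kernel read through the shift:
`∫ Ψ dγ_{Λ₀ − c}(·|ζ) = ∫ Ψ(θ_{−c} W) dγ_{Λ₀}(W | θ_c ζ)` (`ymSpecification_map_configShift`, Georgii 2011 (5.8)). [folklore] -/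
theorem integral_innerKernel_eq [SecondCountableTopology G] (r : LatticeRep G) (β : ℝ) (Λ₀ : Finset (QuantumLattice.ZdEdge 4))
    (c : Site 4) (ζ : LGConfig 4 G) (Ψ : LGConfig 4 G → ℝ) :
    ∫ W, Ψ W ∂(ymSpecification (d := 4) r.ρ β (Λ₀.map (edgeShift (-c)).toEmbedding) ζ) =
      ∫ W, Ψ (configShift (-c) W) ∂(ymSpecification (d := 4) r.ρ β Λ₀ (configShift c ζ)) := by
  have h := ymSpecification_map_configShift (d := 4) r.ρ r.continuous β (-c) Λ₀ (configShift c ζ)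
  rw [configShift_neg_configShift] at h
  rw [← h, integral_map_equiv]

/-- **Translation bridge, set form**: `γ_{Λ₀}(A | θ_c ζ) = γ_{Λ₀−c}(θ_c⁻¹ A | ζ)`. [folklore] -/
theorem innerKernel_real_preimage_eq [SecondCountableTopology G] (r : LatticeRep G) (β : ℝ) (Λ₀ : Finset (QuantumLattice.ZdEdge 4))
    (c : Site 4) (ζ : LGConfig 4 G) {A : Set (LGConfig 4 G)} (hA : MeasurableSet A) :
    (ymSpecification (d := 4) r.ρ β Λ₀ (configShift c ζ)).real A =
      (ymSpecification (d := 4) r.ρ β (Λ₀.map (edgeShift (-c)).toEmbedding) ζ).real {U | configShift c U ∈ A} := by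
  have hA' : MeasurableSet {U : LGConfig 4 G | configShift c U ∈ A} := hA.preimage (configShift c).measurable
  have hfun : ∀ W : LGConfig 4 G,
      ({U : LGConfig 4 G | configShift c U ∈ A}.indicator (1 : LGConfig 4 G → ℝ)) (configShift (-c) W) = A.indicator 1 W := by
    intro W
    have hiff : configShift (-c) W ∈ {U : LGConfig 4 G | configShift c U ∈ A} ↔ W ∈ A := by
      simp only [Set.mem_setOf_eq, configShift_configShift_neg]
    by_cases hW : W ∈ A
    · rw [Set.indicator_of_mem hW, Set.indicator_of_mem (hiff.2 hW), Pi.one_apply, Pi.one_apply]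
    · rw [Set.indicator_of_notMem hW, Set.indicator_of_notMem (fun h => hW (hiff.1 h))]
  rw [← integral_indicator_one hA, ← integral_indicator_one hA', integral_innerKernel_eq]
  exact integral_congr_ae (ae_of_all _ fun W => (hfun W).symm)

end Bridge

/-! ### §4. DLR consistency of the lattice Yang–Mills kernels inside `ℤ⁴` -/

section Consistency

variable {G : Type} [Group G] [TopologicalSpace G] [IsTopologicalGroup G] [CompactSpace G]
  [MeasurableSpace G] [BorelSpace G]

/-- **Consistency, integral form**: for `Λ' ⊆ Λ` and a bounded measurable `Ψ`,
`∫ (∫ Ψ dγ_{Λ'}(·|ζ)) dγ_Λ(ζ|η) = ∫ Ψ dγ_Λ(·|η)` (Georgii 2011 Def. 1.23 (iii); tree `isSpecification_ymSpecification_of_t2Space`,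
`IsSpecification.integral_integral_consistent`). [folklore] -/
theorem integral_ymSpecification_consistent (r : LatticeRep G) (β : ℝ) {Λ Λ' : Finset (QuantumLattice.ZdEdge 4)} (hsub : Λ' ⊆ Λ)
    (η : LGConfig 4 G) {Ψ : LGConfig 4 G → ℝ} (hΨm : Measurable Ψ) {C : ℝ} (hΨC : ∀ W, |Ψ W| ≤ C) :
    ∫ ζ, (∫ W, Ψ W ∂(ymSpecification (d := 4) r.ρ β Λ' ζ)) ∂(ymSpecification (d := 4) r.ρ β Λ η) =
      ∫ W, Ψ W ∂(ymSpecification (d := 4) r.ρ β Λ η) := by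
  haveI : SecondCountableTopology G := r.secondCountableTopology
  haveI : T2Space G := r.t2Space
  haveI := isProbabilityMeasure_ymSpecification r.ρ r.continuous β Λ η
  have hγ : IsSpecification (ymSpecification (d := 4) r.ρ β) := isSpecification_ymSpecification_of_t2Space r.ρ r.continuous β
  exact hγ.integral_integral_consistent hsub η
    (Integrable.of_bound hΨm.aestronglyMeasurable C (ae_of_all _ fun W => by rw [Real.norm_eq_abs]; exact hΨC W))

/-- **Consistency, set form**: `∫ γ_{Λ'}(A | ζ) dγ_Λ(ζ | η) = γ_Λ(A | η)` for `Λ' ⊆ Λ` and measurable `A`. [folklore] -/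
theorem measureReal_ymSpecification_consistent (r : LatticeRep G) (β : ℝ) {Λ Λ' : Finset (QuantumLattice.ZdEdge 4)} (hsub : Λ' ⊆ Λ)
    (η : LGConfig 4 G) {A : Set (LGConfig 4 G)} (hA : MeasurableSet A) :
    ∫ ζ, (ymSpecification (d := 4) r.ρ β Λ' ζ).real A ∂(ymSpecification (d := 4) r.ρ β Λ η) =
      (ymSpecification (d := 4) r.ρ β Λ η).real A := by
  have h := integral_ymSpecification_consistent r β hsub η (Ψ := A.indicator 1) ((measurable_const).indicator hA) (C := 1)
    (fun W => by by_cases hW : W ∈ A <;> simp [hW])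
  simp only [integral_indicator_one hA] at h
  exact h

end Consistency

end Summit.QuantumFields.YangMills.Theorems.SoftLoopLongLag

end
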